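import Summits.QuantumFields.QCD.Theorems.WilsonMobilityGapMobilityGapSketchDefs
import Summits.QuantumFields.QCD.Theorems.MobilityGap.Negative.LowerPin
import Summits.QuantumFields.QCD.Theorems.PauliWegnerSeaFMClosureUnquenchedHopping
import Summits.QuantumFields.QCD.Theorems.SpectralDefectExtinctionPositivityDeficitLeDefects
import Literature.MathematicalPhysics.QuantumFieldTheory.QCDPhaseQuenchedPositivity
import Literature.MathematicalPhysics.QuantumFieldTheory.QCDPhaseQuenchedMomentUpgrade
import Literature.MathematicalPhysics.QuantumFieldTheory.QCDWickMinorMeasurability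

/-!
# Crux `MobilityGap` (stmt-QuantumFields-9150) — line `Sketch`: the kernel-checked reduction

`MobilityGap ⇐ LawBadFloor ∧ LawLower ∧ LawSign ⇐ LawLightMoment ∧ LawLower ∧ LawExtinct`
(`MobilityGap_of_laws`, `MobilityGap_of_stubLaws`; the second is registered on the crux): the whole
sorry-free glue of the registered skeleton `Cruxes/MobilityGap/Lines/Sketch.lean` (reshape 2, lead seat
prover-line-stmt-QuantumFields-9150-c1-0, 2026-08-16) over the definitions file
`WilsonMobilityGapMobilityGapSketchDefs.lean` — so that the three registered stubs `stub_lightMoment`,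
`stub_lower`, `stub_extinct` (statements = `LawLightMoment`, `LawLower`, `LawExtinct` unfolded) are, by
kernel, jointly sufficient for the crux BY NAME, and each can be promoted to an item on its own.

§A the anchor (the floor `1/10` is good eventually, from the landed hopping bound — so the floor set is
non-empty and `-1 ≤ thrMass ≤ 1/10`) · §B the entry sum as a random variable and Markov from below ·
§C light glue (`LawLight → LawLightMoment → LawBadFloor`) · §D sign glue (`LawExtinct → LawSign`, Markov on
the landed `PositivityDeficitLeDefects`) · §E the composition (both scalings are identities, (i) from
`-1 ≤ thrMass`, (ii) BY DEFINITION of the threshold — the realised tuple lies strictly above the infimum,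
hence above a good floor, hence is certified — (iii) from the light point and the lower law, (iv) from the
sign law).  No statement of the route is restated; the conclusion is `WilsonMobilityGap.MobilityGap` itself.
-/

noncomputable section

namespace Summit.QuantumFields.QCD.Theorems.MobilityGapSketch

open scoped BigOperators Topology
open MeasureTheory Filter Set
open Literature.MathematicalPhysics.QuantumFieldTheory Literature.MathematicalPhysics.QuantumLattice
  Literature.Probability.LatticeModels
open Summit.QuantumFields.QCD.Theorems.MobilityGapNegative (norm_single_natCast)

/-! ### §A The anchor: the floor `1/10` is good eventually, for every large rate `δ` -/

/-- **HEAVY-MASS ANCHOR** from the landed hopping bound `ThickCollarFarStability.stub_hopping`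
(`Theorems/PauliWegnerSeaFMClosureUnquenchedHopping.lean`): bare masses `≥ 1/10` have
`|m + 4| ≥ 41/10`, so `fm ≤ C e^{-μ·½·‖v‖}` for every `β`, `S`, sea (`C ≥ 0`, LATTICE rate `μ > 0`);
for `δ ≥ max C 1` the amplitude `e^{δ}` dominates `C`, and the lattice rate `μ/2` beats the physical
rate `δ a_k` as soon as `δ a_k ≤ μ/2`. Consequence: for every large `δ`, eventually in `k`, the floor
set is non-empty and `-1 ≤ thrMass ≤ 1/10`. -/
theorem anchor (Nf : ℕ) :
    ∀ᶠ δ in atTop, ∀ᶠ k in atTop, (1 / 10 : ℝ) ∈ floorSet Nf δ k := by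
  obtain ⟨C, μ, hC0, hμ, hhop⟩ :=
    Summit.QuantumFields.QCD.Theorems.ThickCollarFarStability.stub_hopping Nf
  filter_upwards [eventually_ge_atTop (max C 1)] with δ hδ
  have hδ1 : 1 ≤ δ := (le_max_right C 1).trans hδ
  have hδpos : 0 < δ := one_pos.trans_le hδ1
  have hCδ : C ≤ Real.exp δ :=
    ((le_max_left C 1).trans hδ).trans (by have := Real.add_one_le_exp δ; linarith)
  have hμδ : 0 < μ / (2 * δ) := div_pos hμ (by positivity)
  filter_upwards [tendsto_aSeq.eventually (eventually_le_nhds hμδ)] with k hk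
  have hak : δ * aSeq k ≤ μ / 2 := by
    have := mul_le_mul_of_nonneg_left hk hδpos.le
    calc δ * aSeq k ≤ δ * (μ / (2 * δ)) := this
      _ = μ / 2 := by field_simp
  refine ⟨by norm_num, fun t ht _ S _ f v hv => ?_⟩
  have h41 : (41 / 10 : ℝ) ≤ |t f + 4| := by
    have := ht f
    rw [abs_of_nonneg (by linarith)]
    linarith
  have hb := hhop (betaSeq Nf k) t f h41 S (1 / 2) (by norm_num) (by norm_num) v hv
  have hv0 : 0 ≤ ‖v‖ := norm_nonneg _
  calc fm Nf (betaSeq Nf k) t S f v (1 / 2) ≤ C * Real.exp (-(μ * (1 / 2) * ‖v‖)) := hb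
    _ ≤ Real.exp δ * Real.exp (-(δ * (aSeq k * ‖v‖))) := by
        apply mul_le_mul hCδ _ (Real.exp_pos _).le (Real.exp_pos _).le
        apply Real.exp_le_exp.2
        have : δ * (aSeq k * ‖v‖) = (δ * aSeq k) * ‖v‖ := by ring
        rw [this]
        nlinarith


/-- The floor set is non-empty eventually (for every large `δ`). -/
theorem floorSet_nonempty (Nf : ℕ) :
    ∀ᶠ δ in atTop, ∀ᶠ k in atTop, (floorSet Nf δ k).Nonempty :=
  (anchor Nf).mono fun _ hδ => hδ.mono fun _ hk => ⟨_, hk⟩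

/-- `thrMass ≤ 1/10` eventually (the threshold is never lattice-heavy from ABOVE; lattice-heaviness from
below — the supercritical plateau — is excluded by `stub_lightMoment`). -/
theorem thrMass_le_tenth (Nf : ℕ) :
    ∀ᶠ δ in atTop, ∀ᶠ k in atTop, thrMass Nf δ k ≤ 1 / 10 :=
  (anchor Nf).mono fun _ hδ => hδ.mono fun _ hk => thrMass_le_of_mem hk


/-! ### §B The entry sum as a random variable; Markov from below -/

/-- The entry sum is measurable in the gauge field. -/
theorem measurable_propSum (Nf S : ℕ) (t : Fin Nf → ℝ) (f : Fin Nf)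
    (v : Literature.Probability.LatticeModels.Site 4) : Measurable (propSum Nf S t f v) := by
  refine Finset.measurable_sum _ fun a _ => Finset.measurable_sum _ fun i _ =>
    Finset.measurable_sum _ fun b _ => Finset.measurable_sum _ fun j _ => ?_
  exact (measurable_inv_diracMatrix_apply t _ _).norm

/-- `X_{f,v}` is integrable under the phase-quenched probability measure (the weight `|det D|` kills
the pole: `|det D|·|D⁻¹(p,q)| ≤ |adj D(p,q)|`). -/
theorem integrable_propSum (Nf S : ℕ) (β : ℝ) (t : Fin Nf → ℝ) (f : Fin Nf)
    (v : Literature.Probability.LatticeModels.Site 4) :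
    Integrable (propSum Nf S t f v) (qcdLatticeMeasure (2 * S + 1) β t) :=
  integrable_propagatorEntrySum_qcdLatticeMeasure β t (integral_norm_det_diracMatrix_pos_all β t) f _ _

/-- Fractional powers `X^s`, `0 ≤ s ≤ 1`, are phase-quenched integrable (`y^s ≤ 1 + y`). -/
theorem integrable_propSum_rpow (Nf S : ℕ) (β : ℝ) (t : Fin Nf → ℝ) (f : Fin Nf)
    (v : Literature.Probability.LatticeModels.Site 4) {s : ℝ} (hs0 : 0 ≤ s) (hs1 : s ≤ 1) :
    Integrable (fun U => propSum Nf S t f v U ^ s) (qcdLatticeMeasure (2 * S + 1) β t) := by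
  haveI := isProbabilityMeasure_qcdLatticeMeasure_all (S := 2 * S + 1) β t
  refine Integrable.mono' ((integrable_const (1 : ℝ)).add (integrable_propSum Nf S β t f v))
    ((measurable_propSum Nf S t f v).pow_const s).aestronglyMeasurable
    (Eventually.of_forall fun U => ?_)
  rw [Real.norm_eq_abs, abs_of_nonneg (Real.rpow_nonneg (propSum_nonneg Nf S t f v U) _)]
  exact Literature.Probability.Moments.rpow_le_one_add (propSum_nonneg Nf S t f v U) hs0 hs1

/-- `fm` IS the `s`-th moment of `X_{f,v}` under the phase-quenched probability measure
`qcdLatticeMeasure (2S+1) β t` (tree: `qcdPhaseQuenchedExpect_eq_div`,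
`qcdPhaseQuenchedExpect_eq_integral_qcdLatticeMeasure`). -/
theorem fm_eq_integral (Nf : ℕ) (β : ℝ) (t : Fin Nf → ℝ) (S : ℕ) (f : Fin Nf)
    (v : Literature.Probability.LatticeModels.Site 4) (s : ℝ) :
    fm Nf β t S f v s = ∫ U, propSum Nf S t f v U ^ s ∂(qcdLatticeMeasure (2 * S + 1) β t) := by
  rw [← qcdPhaseQuenchedExpect_eq_integral_qcdLatticeMeasure, qcdPhaseQuenchedExpect_eq_div]
  rfl

/-- **Markov from below.** If the phase-quenched probability of `{c ≤ X_{f,v}}` is at least `p`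
(`c ≥ 0`), then `p · c^s ≤ fm … s` for every `0 ≤ s ≤ 1`. -/
theorem mul_rpow_le_fm (Nf : ℕ) (β : ℝ) (t : Fin Nf → ℝ) (S : ℕ) (f : Fin Nf)
    (v : Literature.Probability.LatticeModels.Site 4) {s c p : ℝ} (hs0 : 0 ≤ s) (hs1 : s ≤ 1)
    (hc : 0 ≤ c)
    (hp : p ≤ (qcdLatticeMeasure (2 * S + 1) β t).real {U | c ≤ propSum Nf S t f v U}) :
    p * c ^ s ≤ fm Nf β t S f v s := by
  rw [fm_eq_integral]
  set P := qcdLatticeMeasure (2 * S + 1) β t with hP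
  haveI : IsProbabilityMeasure P := isProbabilityMeasure_qcdLatticeMeasure_all (S := 2 * S + 1) β t
  have hE : MeasurableSet {U | c ≤ propSum Nf S t f v U} :=
    measurableSet_le measurable_const (measurable_propSum Nf S t f v)
  have h1 : ∫ U, {U | c ≤ propSum Nf S t f v U}.indicator (fun _ => c ^ s) U ∂P =
      P.real {U | c ≤ propSum Nf S t f v U} * c ^ s := by
    rw [integral_indicator_const _ hE, smul_eq_mul]
  have h2 : ∫ U, {U | c ≤ propSum Nf S t f v U}.indicator (fun _ => c ^ s) U ∂P ≤
      ∫ U, propSum Nf S t f v U ^ s ∂P := by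
    refine integral_mono ((integrable_const _).indicator hE)
      (integrable_propSum_rpow Nf S β t f v hs0 hs1) fun U => ?_
    by_cases hU : U ∈ {U | c ≤ propSum Nf S t f v U}
    · rw [indicator_of_mem hU]
      exact Real.rpow_le_rpow hc hU hs0
    · rw [indicator_of_notMem hU]
      exact Real.rpow_nonneg (propSum_nonneg Nf S t f v U) _
  calc p * c ^ s ≤ P.real {U | c ≤ propSum Nf S t f v U} * c ^ s :=
        mul_le_mul_of_nonneg_right hp (Real.rpow_nonneg hc _)
    _ ≤ _ := h1 ▸ h2



/-- `n e₀ ∈ box 4 S` for `n ≤ S`. -/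
theorem single_mem_box_of_le {S n : ℕ} (hn : n ≤ S) :
    (Pi.single 0 (n : ℤ) : Literature.Probability.LatticeModels.Site 4) ∈ box 4 S := by
  rw [mem_box]
  intro i
  by_cases hi : i = 0
  · subst hi; simp; omega
  · simp [hi]


/-! ### §C Light glue: `LawLight → LawLightMoment → LawBadFloor` -/

/-- `TypicalLightChannel ⇒ LightMoment` (Markov from below). -/
theorem lightMoment_of_typicalLightChannel {Nf : ℕ} (h : TypicalLightChannel Nf) : LightMoment Nf := by
  obtain ⟨r, hk⟩ := h
  refine ⟨r / 2, hk.mono fun k hkk => ?_⟩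
  obtain ⟨x, hx, f, c, π₀, hc, hπ, S₀, hS⟩ := hkk
  refine ⟨x, hx, f, π₀ * c ^ (1 / 2 : ℝ), mul_pos hπ (Real.rpow_pos_of_pos hc _), S₀,
    fun S hSS n hn => ?_⟩
  have hlow := mul_rpow_le_fm Nf (betaSeq Nf k) (fun _ => x) S f (Pi.single 0 (n : ℤ))
    (s := 1 / 2) (by norm_num) (by norm_num) (mul_nonneg hc.le (Real.exp_pos _).le) (hS S hSS n hn)
  have hval : π₀ * (c * Real.exp (-(r * (aSeq k * n)))) ^ (1 / 2 : ℝ) =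
      π₀ * c ^ (1 / 2 : ℝ) * Real.exp (-(r / 2 * (aSeq k * n))) := by
    rw [Real.mul_rpow hc.le (Real.exp_pos _).le, ← Real.exp_mul, ← mul_assoc]
    congr 2
    ring
  rw [← hval]
  exact hlow

/-- **A light ½-moment yields a bad floor above `-1` for every `δ > r`**: at distance
`n > (δ - log c)/((δ - r) a_k)` along `e₀` on the torus of side `2 max(S₀, L⁰_k, n) + 1` the lower bound
`c e^{-r a_k n}` beats the certificate `e^{δ} e^{-δ a_k n}` of the degenerate tuple `x`. -/
theorem eventually_not_isGoodFloor_of_lightMoment {Nf : ℕ} (h : LightMoment Nf) :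
    ∀ᶠ δ in atTop, ∀ᶠ k in atTop, ∃ x : ℝ, -1 < x ∧ ¬ IsGoodFloor Nf δ k x := by
  obtain ⟨r, hk⟩ := h
  filter_upwards [eventually_gt_atTop r] with δ hδ
  filter_upwards [hk] with k hkk
  obtain ⟨x, hx, f, c, hc, S₀, hS⟩ := hkk
  refine ⟨x, hx, fun hgood => ?_⟩
  have hD : 0 < (δ - r) * aSeq k := mul_pos (by linarith) (aSeq_pos k)
  obtain ⟨n, hn⟩ := exists_nat_gt ((δ - Real.log c) / ((δ - r) * aSeq k))
  have hn' : δ - Real.log c < (δ - r) * aSeq k * n := by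
    rwa [div_lt_iff₀ hD, mul_comm] at hn
  set S : ℕ := max (max S₀ (volFloor k)) n with hSdef
  have hS₀ : S₀ ≤ S := (le_max_left _ _).trans (le_max_left _ _)
  have hLS : volFloor k ≤ S := (le_max_right _ _).trans (le_max_left _ _)
  have hnS : n ≤ S := le_max_right _ _
  have hcert : Certified Nf δ k (fun _ => x) :=
    hgood _ (fun _ => le_rfl) (fun _ _ => by simpa using slabWidth_nonneg Nf k)
  have hup := hcert S hLS f (Pi.single 0 (n : ℤ)) (single_mem_box_of_le hnS)
  rw [norm_single_natCast] at hup
  have hlow := hS S hS₀ n hnS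
  have hlt : Real.exp δ * Real.exp (-(δ * (aSeq k * n))) < c * Real.exp (-(r * (aSeq k * n))) := by
    rw [← Real.exp_log hc, ← Real.exp_add, ← Real.exp_add, Real.exp_lt_exp]
    nlinarith [hn']
  exact (lt_irrefl _) ((hlow.trans hup).trans_lt hlt)


/-- `LawLight → LawLightMoment`. -/
theorem lawLightMoment_of_lawLight (h : LawLight) : LawLightMoment :=
  fun Nf hNf => lightMoment_of_typicalLightChannel (h Nf hNf)

/-- `LawLightMoment → LawBadFloor` (composition input 1 from the registered light stub). -/
theorem lawBadFloor_of_lawLightMoment (h : LawLightMoment) : LawBadFloor :=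
  fun Nf hNf => eventually_not_isGoodFloor_of_lightMoment (h Nf hNf)

/-! ### §D Sign glue: `LawExtinct → LawSign` -/

/-- **Markov on the landed positivity-deficit bound.** On any torus, at any coupling and any bare
tuple: if the phase-quenched expected number of deep crossers is `≤ 1/4`, then
`½ ≤ |∫ det D dμ_W| / ∫ |det D| dμ_W` (`PositivityDeficitLeDefects`: `(1 − ⟨sign⟩₊)/2 ≤ E₊[#]`, and
`⟨sign⟩₊ = ∫ Re Π det / ∫ Π|det| ≤ |∫ det diracMatrix| / ∫ |det diracMatrix|` since
`det diracMatrix = Π_f det D_W(t_f)` is integrable and `Z₊ > 0`). -/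
theorem sign_of_extinct {Nf N : ℕ} [NeZero N] (β : ℝ) (t : Fin Nf → ℝ)
    (h : (∫ U : GaugeConfig 4 N (Matrix.specialUnitaryGroup (Fin 3) ℂ),
        (∑ f : Fin Nf, (Multiset.countP (fun z : ℂ => z.im = 0 ∧ z.re < -t f)
          (wilsonDirac (fundamentalRep (Fin 3)) U 0 1).charpoly.roots : ℝ)) *
          ∏ f : Fin Nf, ‖fermionDet (wilsonDirac (fundamentalRep (Fin 3)) U (t f) 1)‖
        ∂(wilsonMeasure (d := 4) (L := N) (fundamentalRep (Fin 3)) β)) /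
      (∫ U : GaugeConfig 4 N (Matrix.specialUnitaryGroup (Fin 3) ℂ),
        ∏ f : Fin Nf, ‖fermionDet (wilsonDirac (fundamentalRep (Fin 3)) U (t f) 1)‖
        ∂(wilsonMeasure (d := 4) (L := N) (fundamentalRep (Fin 3)) β)) ≤ 1 / 4) :
    (1 / 2 : ℝ) ≤
      ‖∫ U : GaugeConfig 4 N (Matrix.specialUnitaryGroup (Fin 3) ℂ),
          (diracMatrix U t).det ∂(wilsonMeasure (fundamentalRep (Fin 3)) β)‖ /
        (∫ U : GaugeConfig 4 N (Matrix.specialUnitaryGroup (Fin 3) ℂ),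
          ‖(diracMatrix U t).det‖ ∂(wilsonMeasure (fundamentalRep (Fin 3)) β)) := by
  set μW := wilsonMeasure (d := 4) (L := N) (fundamentalRep (Fin 3)) β with hμW
  have hP := Summit.QuantumFields.QCD.Theorems.PositivityDeficitLeDefects.positivityDeficitLeDefects_proof
    Nf N β t
  -- `Z₊ = ∫ |det diracMatrix|`, positive
  have hZeq : (∫ U, ∏ f : Fin Nf, ‖fermionDet (wilsonDirac (fundamentalRep (Fin 3)) U (t f) 1)‖ ∂μW) =
      ∫ U, ‖(diracMatrix U t).det‖ ∂μW :=
    integral_congr_ae (Eventually.of_forall fun U => (norm_det_diracMatrix U t).symm)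
  have hZ : 0 < ∫ U, ‖(diracMatrix U t).det‖ ∂μW := integral_norm_det_diracMatrix_pos_all β t
  -- `∫ Re Π det = Re ∫ det diracMatrix ≤ |∫ det diracMatrix|`
  have hdetInt : Integrable (fun U : GaugeConfig 4 N (Matrix.specialUnitaryGroup (Fin 3) ℂ) =>
      (diracMatrix U t).det) μW :=
    (integrable_norm_det_diracMatrix t μW).mono' (continuous_det_diracMatrix t).aestronglyMeasurable
      (Eventually.of_forall fun U => le_rfl)
  have hReq : (∫ U, (∏ f : Fin Nf, fermionDet (wilsonDirac (fundamentalRep (Fin 3)) U (t f) 1)).re ∂μW) =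
      (∫ U, (diracMatrix U t).det ∂μW).re := by
    have h1 : (∫ U, (∏ f : Fin Nf, fermionDet (wilsonDirac (fundamentalRep (Fin 3)) U (t f) 1)).re ∂μW) =
        ∫ U, ((diracMatrix U t).det).re ∂μW :=
      integral_congr_ae (Eventually.of_forall fun U => by simp only [det_diracMatrix])
    rw [h1]
    have h2 := integral_re hdetInt
    simpa using h2
  have hRle : (∫ U, (∏ f : Fin Nf, fermionDet (wilsonDirac (fundamentalRep (Fin 3)) U (t f) 1)).re ∂μW) ≤
      ‖∫ U, (diracMatrix U t).det ∂μW‖ := by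
    rw [hReq]; exact Complex.re_le_norm _
  -- Markov: `(1 - ⟨sign⟩₊)/2 ≤ 1/4`
  have hAZ : (1 / 2 : ℝ) ≤
      (∫ U, (∏ f : Fin Nf, fermionDet (wilsonDirac (fundamentalRep (Fin 3)) U (t f) 1)).re ∂μW) /
        (∫ U, ∏ f : Fin Nf, ‖fermionDet (wilsonDirac (fundamentalRep (Fin 3)) U (t f) 1)‖ ∂μW) := by
    linarith [hP.trans h]
  rw [hZeq] at hAZ
  exact hAZ.trans (div_le_div_of_nonneg_right hRle hZ.le)


/-- `LawExtinct → LawSign` (composition input 3 from the registered extinction stub). -/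
theorem lawSign_of_lawExtinct (h : LawExtinct) : LawSign := by
  intro Nf hNf
  obtain ⟨L, hL, hfl, hδ⟩ := h Nf hNf
  refine ⟨L, hL, hfl, hδ.mono fun δ hd M hM => (hd M hM).mono fun k hk hne hthr t ht₁ ht₂ => ?_⟩
  exact sign_of_extinct (betaSeq Nf k) t (hk hne hthr t ht₁ ht₂)

/-! ### §E The kernel-checked composition -/

/-- **Composition** (sorry-free, standard axioms): the three stub STATEMENTS imply the unfolded crux.
Take `L ≥ L⁰` from the sign clause (`stub_extinct`), `δ > 0` in the intersection of the four `δ`-filters (anchor,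
light point, lower pin, sign clause), `reg := thrReg L δ`; both scalings are identities; for `m > 0`: (i) from `-1 ≤ thrMass` (anchor ⇒
floor set non-empty) and `a_k m_f/Z_m > 0`; (ii) with `(s, δ, C) := (½, δ, e^{δ})` — the realised tuple lies strictly above the
threshold with spread `≤ w_k` eventually, hence is CERTIFIED (`certified_of_thrMass_lt`); (iii) from
the light point (`lightPoint_of_lightMoment stub_lightMoment` ⇒ `-1 < thrMass`) and the lower pin
(`stub_lower`) at `M := Σ_f m_f + 1`; (iv) from the sign clause
(`sign_clause_of_extinct stub_extinct`). -/
theorem composition (h₁ : LawBadFloor) (h₂ : LawLower) (h₃ : LawSign) :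
    ∀ Nf : ℕ, Nf = 2 ∨ Nf = 3 → ∃ reg : QCDRegularisation Nf, Clauses Nf reg := by
  intro Nf hNf
  -- the volume sequence (above the volume floor), from the sign stub
  obtain ⟨L, hL, hfl, hSGδ⟩ := h₃ Nf hNf
  -- choose the threshold rate `δ > 0` in the intersection of the four `δ`-filters (anchor + light + lower + sign)
  obtain ⟨δ, hδ, hne, hLP, hLW, hSG⟩ :=
    ((eventually_gt_atTop (0 : ℝ)).and ((floorSet_nonempty Nf).and
      ((h₁ Nf hNf).and ((h₂ Nf hNf).and hSGδ)))).exists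
  -- the threshold is a genuine point of the branch eventually
  have hthr : ∀ᶠ k in atTop, -1 < thrMass Nf δ k := by
    filter_upwards [hne, hLP] with k hk ⟨x, hx, hxg⟩
    exact hx.trans_le (le_thrMass_of_not_isGoodFloor hk hxg)
  refine ⟨thrReg Nf L hL δ, thrReg_hasMassScaling Nf L hL δ, thrReg_hasAsymptoticScaling Nf L hL δ,
    fun m hm => ?_⟩
  -- the realised bare trajectory and its window
  set M : ℝ := (∑ f, m f) + 1 with hMdef
  have hMpos : 0 < M := by
    have : 0 ≤ ∑ f, m f := Finset.sum_nonneg fun f _ => (hm f).le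
    linarith
  have hmM : ∀ f, m f ≤ M := fun f =>
    (Finset.single_le_sum (fun g _ => (hm g).le) (Finset.mem_univ f)).trans (le_add_of_nonneg_right zero_le_one)
  have hwin₁ : ∀ k f, thrMass Nf δ k < thrMass Nf δ k + aSeq k * m f / zmSeq Nf k := fun k f =>
    lt_add_of_pos_right _ (div_pos (mul_pos (aSeq_pos k) (hm f)) (zmSeq_pos Nf k))
  have hwin₂ : ∀ k f, thrMass Nf δ k + aSeq k * m f / zmSeq Nf k ≤
      thrMass Nf δ k + aSeq k * M / zmSeq Nf k := fun k f => by
    have := div_le_div_of_nonneg_right (mul_le_mul_of_nonneg_left (hmM f) (aSeq_pos k).le)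
      (zmSeq_pos Nf k).le
    linarith
  -- the spread of the realised tuple is within the slab eventually
  have hB : ∀ f g, |m f - m g| ≤ M := fun f g => by
    rw [abs_sub_le_iff]
    constructor <;> linarith [hmM f, hmM g, hm f, hm g]
  have hspread : ∀ᶠ k in atTop, ∀ f g,
      |(thrMass Nf δ k + aSeq k * m f / zmSeq Nf k) - (thrMass Nf δ k + aSeq k * m g / zmSeq Nf k)| ≤
        slabWidth Nf k := by
    filter_upwards [tendsto_natCast_atTop_atTop.eventually_ge_atTop M] with k hk f g
    have ha := aSeq_pos k
    have hz := zmSeq_pos Nf k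
    have hq : 0 < aSeq k / zmSeq Nf k := div_pos ha hz
    have : (thrMass Nf δ k + aSeq k * m f / zmSeq Nf k) - (thrMass Nf δ k + aSeq k * m g / zmSeq Nf k)
        = aSeq k / zmSeq Nf k * (m f - m g) := by ring
    rw [this, abs_mul, abs_of_pos hq]
    calc aSeq k / zmSeq Nf k * |m f - m g| ≤ aSeq k / zmSeq Nf k * (k : ℝ) :=
          mul_le_mul_of_nonneg_left ((hB f g).trans hk) hq.le
      _ = slabWidth Nf k := by unfold slabWidth; ring
  -- the realised tuple is certified eventually (THE LEVER)
  have hcert : ∀ᶠ k in atTop,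
      Certified Nf δ k (fun fl => thrMass Nf δ k + aSeq k * m fl / zmSeq Nf k) := by
    filter_upwards [hne, hspread] with k hk hsp
    exact certified_of_thrMass_lt hk (fun f => hwin₁ k f) hsp
  refine ⟨?_, ?_, ?_, ?_⟩
  · -- clause (i)
    intro f
    filter_upwards [hne] with k hk
    show -1 < thrMass Nf δ k + aSeq k * m f / zmSeq Nf k
    have h1 := neg_one_le_thrMass hk
    have h2 : 0 < aSeq k * m f / zmSeq Nf k := div_pos (mul_pos (aSeq_pos k) (hm f)) (zmSeq_pos Nf k)
    linarith
  · -- clause (ii): BY DEFINITION of the threshold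
    refine ⟨1 / 2, δ, Real.exp δ, by norm_num, by norm_num, hδ, ?_⟩
    filter_upwards [hcert, hfl] with k hck hflk S hS f v hv
    exact hck S (hflk.trans hS) f v hv
  · -- clause (iii)
    obtain ⟨s, c₀, C₁, p, hs, hs1, hc₀, hT⟩ := hLW M hMpos
    refine ⟨s, c₀, C₁, p, hs, hs1, hc₀, ?_⟩
    filter_upwards [hne, hthr, hT, hfl] with k hk₀ hk hTk hflk S hS f n hn
    exact hTk hk₀ hk _ (fun f => hwin₁ k f) (fun f => hwin₂ k f) S (hflk.trans hS) f n hn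
  · -- clause (iv)
    filter_upwards [hne, hthr, hSG M hMpos] with k hk₀ hk hSk
    exact hSk hk₀ hk _ (fun f => hwin₁ k f) (fun f => hwin₂ k f)


/-- **The crux from the three composition inputs** (`MobilityGap` is definitionally
`∀ Nf ∈ {2,3}, ∃ reg, Clauses Nf reg`). -/
theorem MobilityGap_of_laws (h₁ : LawBadFloor) (h₂ : LawLower) (h₃ : LawSign) :
    Summit.QuantumFields.QCD.Theses.WilsonMobilityGap.MobilityGap :=
  composition h₁ h₂ h₃

/-- **The crux from the three registered stub laws** (registered on stmt-QuantumFields-9150):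
`LawLightMoment → LawLower → LawExtinct → MobilityGap`. -/
theorem MobilityGap_of_stubLaws :
    LawLightMoment → LawLower → LawExtinct →
      Summit.QuantumFields.QCD.Theses.WilsonMobilityGap.MobilityGap :=
  fun h₁ h₂ h₃ => MobilityGap_of_laws (lawBadFloor_of_lawLightMoment h₁) h₂ (lawSign_of_lawExtinct h₃)

end Summit.QuantumFields.QCD.Theorems.MobilityGapSketch

end
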